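import Literature.AlgebraicGeometry.Frobenioids.PerfectionUntrCommuteElem
import Literature.AlgebraicGeometry.Frobenioids.PerfectionIsFrobenioid
import HarnessLib

/-!
# [FrdI] Prop. 5.5 (ii), first clause — the compatibility clauses WITHOUT the hypothesis "`C^pf` is a Frobenioid"

[cite: MochizukiFrdI2008, Prop. 5.5 (ii) p.104]

Mochizuki, *The geometry of Frobenioids I*, Prop. 5.5 (ii) p. 104 with Prop. 3.2 (iii) p. 58.  The compatibility
clauses of `PerfectionUntrCommute.lean` / `PerfectionUntrCommuteElem.lean` (and of the slot
`FrdI.Prop55Sub.Prop55ii_untr`) quantify over `hPf : IsFrobenioid (Perfection.ops hF).toFunctor` ("`C^pf` is a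
Frobenioid", Prop. 3.2 (iii)), needed to FORM the structure functor `untrFunctor hPf` of `(C^pf)^un-tr`.  That
hypothesis is now a theorem of the tree for `C` of Frobenius-isotropic type (`Perfection.isFrobenioid hF hiso`,
abc-iut-L1-d9, `PerfectionIsFrobenioid.lean`), so this proof-only file records the hypothesis-free forms:
`(C^pf)^un-tr ≌ (C^un-tr)^pf` compatible with the functors to `F_{Φ^pf}` (hence over `D`), for EVERY Frobenioid of
Frobenius-isotropic type. Nothing printed is weakened or strengthened; nothing here bears on [IUTchIII] Cor. 3.12.
-/

namespace Literature.AlgebraicGeometry.Frobenioids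

namespace PreFrobenioid

open CategoryTheory Opposite

universe w v v' u u'

variable {D : Type u} [Category.{v} D] {Φ : Dᵒᵖ ⥤ CommMonCat.{w}}
  {C : Type u'} [Category.{v'} C] {F : C ⥤ ElemFrobenioid Φ}

/-- **[FrdI] Prop. 5.5 (ii), first clause, hypothesis-free**: for a Frobenioid `C` of Frobenius-isotropic type, THE
comparison functor `(C^pf)^un-tr → (C^un-tr)^pf` is an equivalence, and composed with the structure functor
`(C^un-tr)^pf → F_{Φ^pf}` it is isomorphic to the structure functor `(C^pf)^un-tr → F_{Φ^pf}` of the Frobenioid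
`C^pf` (Prop. 3.2 (iii), `Perfection.isFrobenioid`). [cite: MochizukiFrdI2008, Prop. 5.5 (ii) p.104] -/
theorem prop55ii_untr_elem' (hF : IsFrobenioid F) (hiso : IsOfType (IsFrobeniusIsotropic F)) :
    ∃ e : (Perfection.ops hF).Untr ≌ PreFrobenioid.Perfection (isFrobenioid_untr hF),
      Nonempty (e.functor ⋙ (Perfection.ops (isFrobenioid_untr hF)).toFunctor ≅
        untrFunctor (Perfection.isFrobenioid hF hiso)) :=
  haveI := PerfectionUntr.comparison_isEquivalence (hF := hF) hiso
  ⟨(PerfectionUntr.comparison hF hiso).asEquivalence,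
    PerfectionUntr.nonempty_comparison_comp_toFunctor_iso hiso (Perfection.isFrobenioid hF hiso)⟩

/-- The same over the base `D` (the shape of the slot `FrdI.Prop55Sub.Prop55ii_untr`, with its `∀ hPf` instantiated
at `Perfection.isFrobenioid hF hiso`). [cite: MochizukiFrdI2008, Prop. 5.5 (ii) p.104] -/
theorem prop55ii_untr_base' (hF : IsFrobenioid F) (hiso : IsOfType (IsFrobeniusIsotropic F)) :
    ∃ e : (Perfection.ops hF).Untr ≌ PreFrobenioid.Perfection (isFrobenioid_untr hF),
      Nonempty (e.functor ⋙ (Perfection.ops (isFrobenioid_untr hF)).base ≅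
        (PreFrobenioidData.ofFunctor _ (untrFunctor (Perfection.isFrobenioid hF hiso))).base) := by
  obtain ⟨e, he⟩ := prop55ii_untr hF hiso
  exact ⟨e, he _⟩

end PreFrobenioid

end Literature.AlgebraicGeometry.Frobenioids
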